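import Mathlib
import HarnessLib
import HarnessLib.Audit
import Summits.FinalStateConjecture.Statement
import Literature.Geometry.Lorentzian.Stationary
import Literature.Geometry.Lorentzian.KerrData
import Literature.Geometry.Lorentzian.Einstein
import Summits.FinalStateConjecture.FinalStateConjecture.Theorems.SignedCensusAssembly
import HarnessLib.Audit.Status.Attr

/-!
Route: SignedCensus

DORMANT since 2026-08-22T07:24:16Z (reconciler: no traction for 5.2 d (last activity item-evidence-added at 2026-08-17T02:49:09Z); parked, not closed — `ledger route dormant route-FinalStateConjecture-SignedCensus --off` to reactivate) — unstaffed, not closed; items shared with open routes are served there. `ledger route dormant <id> --off` reactivates.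

# Route SignedCensus — Count, don't continue: smooth no-hair by induction on horizon rotation from
the static anchor (census of stationary black holes), then Kerr final states

It suffices to show X := GradedNoHair ∧ NoHairToFinalState. GradedNoHair (the statement the card's
mechanism decides):
for every level s ∈ ℝ, every SMOOTH (no analyticity, no closeness to Kerr, no axisymmetry)
stationary asymptotically flat
vacuum black-hole spacetime 𝓑 (prelude structure `StationaryAFBlackHole`: complete stationary
Killing field T timelike on
M_ext, AF end) which is REGULAR (carrier globally hyperbolic with the slice a Cauchy hypersurface —
the corrected notion `LorentzianMetric.IsCauchyHypersurface`, rev 3), whose future event horizon 𝓔⁺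
is connected and non-degenerate, with T normalised (g(T,T) → −1 along the end) and HORIZON ROTATION
LEVEL at most s
(g_p(T,T) ≤ s at every p ∈ 𝓔⁺; Kerr: sup = a²/r₊²; this is exactly the smallness parameter
‖g(T,T)‖_L∞(S₀) of
Alexakis–Ionescu–Klainerman 2014) has domain of outer communications isometric to a subextremal Kerr
exterior — the
gr.S23 / AIK schema `AlexakisIonescuKlainermanRigidity` at an explicit smooth regularity predicate,
graded by s (since rev 3 written UNFOLDED over `StationaryAFBlackHole`, without the bookkeeping
binder `hres`, conclusion `IsIsometricToKerrExterior` unfolded pointwise through dΦ — so the route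
imports only the fact-free prelude files Stationary/KerrData/Einstein). It is
reached by REAL INDUCTION on s from three cruxes — StaticAnchor (s = 0: T null on 𝓔⁺ ⇒ static ⇒
Schwarzschild),
OpenUnderRotation (the exotic-free levels are right-open: compactness + isolation) and
ClosedUnderRotation (left-closed:
no first exotic hole = fold / odd-state exclusion) — the typed shadow of the card's signed census
(degree one of the
horizon chart from the static anchor); the induction is the proved deciding theorem.
NoHairToFinalState is the shared
dynamical leg (weak cosmic censorship + asymptotic stationarity + Kerr charts) turning graded
no-hair into the Statement.
Realises card signed-census-stationary-black-holes (spine).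
Lean: `(∀ s : ℝ, ∀ (𝓑 : Literature.Geometry.Lorentzian.StationaryAFBlackHole.{0})
[𝓑.metric.HasLeviCivita] [Literature.Geometry.Lorentzian.Kerr.Facts] (hF :
𝓑.metric.isOpen_chronologicalFuture 𝓑.timeOrientation) (hP : 𝓑.metric.isOpen_chronologicalPast
𝓑.timeOrientation), 𝓑.metric.IsGloballyHyperbolic 𝓑.timeOrientation → 𝓑.metric.IsCauchyHypersurface
𝓑.timeOrientation (Set.range 𝓑.embed) → IsConnected 𝓑.horizon → 𝓑.toSpacetime.IsNonDegenerateHorizon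
𝓑.Mext → Filter.Tendsto (fun x ↦ 𝓑.metric.val (𝓑.embed x) (𝓑.killing (𝓑.embed x)) (𝓑.killing
(𝓑.embed x))) (⨅ R : ℝ, Filter.principal (𝓑.e.far R)) (nhds (-1)) → (∀ p ∈ 𝓑.horizon, 𝓑.metric.val p
(𝓑.killing p) (𝓑.killing p) ≤ s) → 𝓑.metric.toPseudoRiemannianMetric.IsRicciFlat → ∃ (M a : ℝ) (_ :
Literature.Geometry.Lorentzian.Kerr.IsSubextremal M a) (Φ : Diffeomorph (𝓡 4) 𝓘(ℝ,
Literature.Geometry.Lorentzian.E4) (𝓑.docOpens hF hP) (Literature.Geometry.Lorentzian.Kerr.exterior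
M a) ((⊤ : ℕ∞) : WithTop ℕ∞)), ∀ (y : 𝓑.docOpens hF hP) (v w : EuclideanSpace ℝ (Fin 4)),
(Literature.Geometry.Lorentzian.Kerr.smoothMetric M a (Literature.Geometry.Lorentzian.Kerr.rPlus M
a)).val (Φ y) (mfderiv (𝓡 4) 𝓘(ℝ, Literature.Geometry.Lorentzian.E4) Φ y v) (mfderiv (𝓡 4) 𝓘(ℝ,
Literature.Geometry.Lorentzian.E4) Φ y w) = 𝓑.metric.val y.1 v w) ∧ ((∀ s : ℝ, ∀ (𝓑 :
Literature.Geometry.Lorentzian.StationaryAFBlackHole.{0}) [𝓑.metric.HasLeviCivita]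
[Literature.Geometry.Lorentzian.Kerr.Facts] (hF : 𝓑.metric.isOpen_chronologicalFuture
𝓑.timeOrientation) (hP : 𝓑.metric.isOpen_chronologicalPast 𝓑.timeOrientation),
𝓑.metric.IsGloballyHyperbolic 𝓑.timeOrientation → 𝓑.metric.IsCauchyHypersurface 𝓑.timeOrientation
(Set.range 𝓑.embed) → IsConnected 𝓑.horizon → 𝓑.toSpacetime.IsNonDegenerateHorizon 𝓑.Mext →
Filter.Tendsto (fun x ↦ 𝓑.metric.val (𝓑.embed x) (𝓑.killing (𝓑.embed x)) (𝓑.killing (𝓑.embed x))) (⨅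
R : ℝ, Filter.principal (𝓑.e.far R)) (nhds (-1)) → (∀ p ∈ 𝓑.horizon, 𝓑.metric.val p (𝓑.killing p)
(𝓑.killing p) ≤ s) → 𝓑.metric.toPseudoRiemannianMetric.IsRicciFlat → ∃ (M a : ℝ) (_ :
Literature.Geometry.Lorentzian.Kerr.IsSubextremal M a) (Φ : Diffeomorph (𝓡 4) 𝓘(ℝ,
Literature.Geometry.Lorentzian.E4) (𝓑.docOpens hF hP) (Literature.Geometry.Lorentzian.Kerr.exterior
M a) ((⊤ : ℕ∞) : WithTop ℕ∞)), ∀ (y : 𝓑.docOpens hF hP) (v w : EuclideanSpace ℝ (Fin 4)),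
(Literature.Geometry.Lorentzian.Kerr.smoothMetric M a (Literature.Geometry.Lorentzian.Kerr.rPlus M
a)).val (Φ y) (mfderiv (𝓡 4) 𝓘(ℝ, Literature.Geometry.Lorentzian.E4) Φ y v) (mfderiv (𝓡 4) 𝓘(ℝ,
Literature.Geometry.Lorentzian.E4) Φ y w) = 𝓑.metric.val y.1 v w) → FinalStateConjecture)`

## Assembly
Pure logic plus the order-completeness of ℝ (sorry-free, `theorem closes`, re-certified at rev 3):
let P s be the
common graded predicate; P is antitone in s (a larger level is a stronger statement); S := {s ≥ 0 |
¬P s}; if S ≠ ∅ put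
t := inf S ≥ 0; every level below t satisfies P, so P t holds by StaticAnchor (t = 0) or
ClosedUnderRotation (t > 0);
OpenUnderRotation gives P t' for some t' > t, and antitonicity contradicts the choice of t. Hence ∀
s, P s = GradedNoHair,
and NoHairToFinalState yields `FinalStateConjecture`. CensusUniqueness and GradedNoHair are not
hypotheses of `closes`. Route-choice repair 2026-08-16 (rev 4, clears `route.target-unreachable`):
the glue item LevelInduction (support, provable now) := `StaticAnchor → OpenUnderRotation →
ClosedUnderRotation → GradedNoHair` — exactly this real induction, i.e. the body of `closes` after
`apply hD` — puts the target X = GradedNoHair inside the item graph: cruxes → GradedNoHair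
(LevelInduction) → `FinalStateConjecture` (NoHairToFinalState, whose hypothesis is GradedNoHair
unfolded); `closes` itself is unchanged.

Rationale: WHY THIS LINE. Ionescu–Klainerman show that a second Killing field cannot be CONTINUED off a smooth
horizon from local information
(arXiv:1108.3575 Thm 1.3, the catalogued barrier) and conclude that "a full proof of the rigidity
conjecture must rely on
global properties of the space-time" (arXiv:1501.01587 §4); the card answers with a global COUNT
instead of a continuation:
treat Ric = 0 on T-invariant metrics, smooth across 𝓔⁺ (a radial set where smoothness replaces
boundary data, Vasy
arXiv:1012.4391; Fredholm index 0 realised for linearised gravity on Kerr, arXiv:1906.00860 §1.1,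
zero modes = δKerr +
gauge for all |a| < M, arXiv:2207.12952 Thm 1.1), as a proper Fredholm problem over the horizon data
and normalise the
degree at the NON-ROTATING anchor, where Sudarsky–Wald staticity (doi:10.1103/PhysRevD.47.R5209)
with Chruściel–Wald
maximal slices and Chruściel–Galloway static uniqueness (arXiv:1004.0513) give uniqueness without
analyticity
(arXiv:1205.6112 §3.3.1). Imported areas: nonlinear Fredholm / degree theory of proper maps (Smale,
Fitzpatrick–
Pejsachowicz–Rabier; run for EXISTENCE of Einstein metrics by Anderson, math/0105243, and
Anderson–Khuri, arXiv:0909.4550)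
and non-elliptic microlocal Fredholm theory — both pointed at RIGIDITY for the first time; plus
elementary covering-space
topology (CensusUniqueness). Typed today in its crudest form, a continuity method along the one
scale-free horizon datum the
prelude can express — the rotation level s, which is AIK's own smallness parameter (arXiv:1304.0487
Thm 1.1, (1.5)) — so
that the assembly is literally induction over ℝ (glue.lean, sorry-free); unlike every recorded
approach (analyticity,
near-Kerr Carleman sweeps, axisymmetry) nothing is continued, finite kernels are allowed and
counted, and the residue of
no-hair splits into compactness (Open) and fold exclusion (Closed), each separately refutable;
negatives index empty.

RANKED CRUXES. #0 GradedNoHair (target) — rotation-graded smooth no-hair: for every s ∈ ℝ, every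
regular (globally hyperbolic carrier, the slice a Cauchy hypersurface) smooth stationary AF vacuum
black hole with connected non-degenerate future event horizon, stationary Killing field T normalised
at infinity and g(T,T) ≤ s on the horizon, has d.o.c. isometric to a subextremal Kerr exterior (AIK
schema at the graded smooth predicate; card thesis 'SmoothNoHairOn every window'). (why it might
fail: this IS the smooth rigidity conjecture (CCH Conj. 3.4 / AIK conjecture) in graded form: one
exotic smooth stationary AF vacuum hole with connected non-degenerate horizon refutes it; I–K germs
show local methods cannot decide it. Typing, rev 3: AIK schema unfolded, corrected
`IsCauchyHypersurface`, no `hres`; the rev-2 clause `IsCauchySurface` was uninhabited — refuter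
evidence W_SC.lean — and is gone from all five decls.) [arXiv:1205.6112, arXiv:1501.01587,
arXiv:1108.3575, arXiv:0904.0982]
#2 ClosedUnderRotation (crux) — the set of exotic-free rotation levels is left-closed: for s > 0, if
no-hair holds up to every level s' < s then it holds up to level s — no exotic hole is the FIRST of
its kind (card K3: no fold / odd-state exclusion off the Kerr curve; layer 2: the level map on the
moduli space is open at every exotic point and the Kerr curve is properly embedded). [difficulty:
open-problem] (why it might fail: an isolated exotic component or the lower tip of a fold pair sits
exactly at a first level s; static (m=0) zero modes off the Kerr curve have no separability, no
Robinson identity and no sign of canonical energy to forbid them.) [doi:10.1103/PhysRevLett.26.331,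
arXiv:1201.0463, hep-th/0412118, arXiv:1205.6112, math/0105243]
#3 OpenUnderRotation (crux) — the set of exotic-free rotation levels is right-open: for s ≥ 0,
no-hair up to level s implies no-hair up to some level s' > s (card K1+K2 at the frontier:
compactness of regular stationary vacuum holes with bounded level modulo scale and diffeomorphisms,
plus isolation of the Kerr family — horizon-regular stationary linearised operator Fredholm of index
0 with kernel = δKerr ⊕ gauge; at s = 0 this is a UNIVERSAL Alexakis–Ionescu–Klainerman strip).
[difficulty: open-problem] (why it might fail: needs a-priori compactness of stationary vacuum holes
with bounded level (Anderson's curvature bound degenerates at the ergosurface; κ→0 and zero-energy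
trapping islands are non-compact/non-Fredholm directions) — AIK's ε depends on quantitative
constants.) [arXiv:1304.0487, gr-qc/0001091, arXiv:1906.00860, arXiv:2207.12952, arXiv:1012.4391]
#4 StaticAnchor (crux again since rev 8, 2026-08-16 crux-only ruling: `closes` assumes it and it is
not provable as typed — p99144 proves it only from the Sudarsky–Wald / Chruściel–Galloway named
facts AND the unpublished bridges B1 (route predicate ⇒ Chruściel–Costa I⁺-regularity) and B2
(T-witness on 𝓔⁺)) — level 0 is exotic-free: a regular smooth stationary AF vacuum black hole with
connected non-degenerate horizon on which the (normalised) stationary Killing field is causal —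
hence null and tangent to the generators: a non-rotating horizon — has d.o.c. isometric to a Kerr
exterior (indeed Schwarzschild: maximal slice ⇒ Sudarsky–Wald staticity ⇒ static uniqueness without
analyticity). [difficulty: L] (why it might fail: Sudarsky–Wald needs an AF maximal slice ending on
a bifurcation sphere and T ≠ 0 on 𝓔⁺; from our predicate (globally hyperbolic carrier, Cauchy slice
through 𝓔⁺) one must first derive I⁺-regularity and a Rácz–Wald bifurcate extension.)
[doi:10.1103/PhysRevD.47.R5209, doi:10.1007/BF02101463, arXiv:1004.0513, arXiv:1205.6112]
#5 NoHairToFinalState (crux) — the dynamical leg: rotation-graded smooth no-hair implies the final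
state conjecture as typed (since the re-type T2, p126844, 2026-08-16: TAME-generic admissible data —
`IsTameChristodoulouGeneric` on one fixed end —: MGHD, complete 𝓘⁺, d.o.c. settling to finitely many
regular non-degenerate stationary vacuum exteriors + radiation, which graded no-hair identifies as
subextremal Kerr, with exhaustive charts at honest near-zone radii, future-oriented chart time
(`IsFutureOriented`) and every future-complete null ray from Σ in the closure of the settled region
(`RaysStayInClosure`); the crux concludes `FinalStateConjecture` by name, so these conjuncts are its
obligations). Shared with every stationary-limit route; deliberately ranked last here. [deps:
GradedNoHair] [difficulty: open-problem] (why it might fail: carries weak cosmic censorship,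
large-data asymptotic stationarity, sub-extremality of limits and subextremal Kerr stability, all
open; and curve-genericity (m = 1) of the typed Statement may itself fail at accumulating threshold
walls.) [arXiv:1710.01722, arXiv:2104.08222, arXiv:2104.11857, arXiv:0811.0354]
#9 CensusUniqueness (support) — the abstract census in its no-fold form: a proper local
homeomorphism from a Hausdorff space onto a connected space one of whose fibres is a single point is
injective (it is a finite covering; fibre cardinality is locally constant). Layer-2 engine: with the
moduli space 𝔐 (definition request), Π proper (Open) + Π a local homeomorphism (Closed) + the static
fibre a singleton (StaticAnchor) give GradedNoHair in one shot. [difficulty: provable-now]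
[doi:10.2307/2039880, arXiv:0909.4550]
#9 LevelInduction (support; glue cruxes → target, route-choice repair 2026-08-16) — StaticAnchor →
OpenUnderRotation → ClosedUnderRotation → GradedNoHair: real induction on the rotation level (the
graded predicate P s is antitone in s; if some level ≥ 0 fails put t := inf of the failing levels; P
t by StaticAnchor (t = 0) or ClosedUnderRotation (t > 0); OpenUnderRotation then gives a level t' >
t with P t', contradicting the choice of t). Provable now — verbatim the body of `closes`; PROVERS:
land it in a Theses-free module in frame form (the four bodies inlined, pattern of
Theorems/EIHFluxBalanceAssemblyFrame.lean) so that the gate's `_holds` link renders without an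
import cycle. [difficulty: provable-now] [arXiv:1304.0487, arXiv:1205.6112]

TWO-LAYER PLAN. Foreseen glued splits (k ≤ 3, depth 1), filed only after a crux closes or the
definition request lands:
OpenUnderRotation ⇐ ProperLevels (sequences of regular stationary vacuum holes with bounded level
subconverge in the
moduli space 𝔐 modulo scale) → KerrIsolated (the Kerr curve is open in 𝔐: horizon-regular stationary
linearised
operator Fredholm of index 0, kernel = δKerr ⊕ gauge, arXiv:1906.00860 + arXiv:2207.12952, then IFT)
→ OpenUnderRotation.
ClosedUnderRotation ⇐ NoFoldOffKerr (the level map 𝔐 → [0,∞) is open at every non-Kerr point: no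
static zero mode at
fixed level, card K3) → KerrProperlyEmbedded (limits of Kerr points of level < 1 in 𝔐 are Kerr) →
ClosedUnderRotation;
alternative one-shot split of GradedNoHair through CensusUniqueness (Π proper ∧ Π local
homeomorphism ∧ static fibre a
singleton), and the SIGNED form (Fitzpatrick–Pejsachowicz–Rabier degree, parity = static zero-mode
crossings, pairing law)
if folds turn out to exist. StaticAnchor ⇐ NonRotatingIsStatic (Chruściel–Wald maximal slice +
Sudarsky–Wald) →
StaticIsKerr (Chruściel–Galloway / Bunting–Masood-ul-Alam) → StaticAnchor. NoHairToFinalState ⇐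
AsymptoticStationarity
(generic data: complete 𝓘⁺ and chart-wise convergence of the d.o.c. to finitely many regular
non-degenerate stationary
vacuum exteriors + radiation) → KerrChartsExhaust (graded no-hair + subextremal Kerr stability
upgrade the limits to an
exhaustive `FinalStateDecomposition`) → NoHairToFinalState.

KILL CRITERIA. Any regular smooth stationary AF vacuum black hole with connected non-degenerate
horizon and d.o.c. NOT isometric to a Kerr
exterior refutes GradedNoHair and, according to where its level sits, ClosedUnderRotation or
OpenUnderRotation: close
`refuted:<Decl>` — this kills every rigidity-based route to the summit and hands the witness to the
card's K4 form (only
ε = +1 states can be generic ω-limits), which would be a NEW route, not a repair. A counterexample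
to StaticAnchor inside our
regularity predicate (a pathology with T null on 𝓔⁺ that is not Schwarzschild) means the predicate
is mis-transcribed:
pivot by `--restate` with Chruściel–Costa I⁺-regularity once expressible, not a close.
¬NoHairToFinalState together with
GradedNoHair is ¬FinalStateConjecture as typed: the summit, not the line, dies. GradedNoHair proved
elsewhere (e.g. by a
zero-energy Carleman route) moots Open/Closed/StaticAnchor and leaves this route =
NoHairToFinalState.

NOT DECOMPOSED YET. (Typing debt retired at rev 3: the statements no longer bind `hres :
PseudoRiemannianMetric.contMDiff_restrict` — a prover who wants the d.o.c. as a `restrict`ed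
pseudo-Riemannian manifold proves that Mathlib-level fact as a `--supports` lemma; `hF`/`hP` are
dischargeable by `isOpen_chronologicalFuture_of_boundaryless`, CausalityOpennessProofs.lean.) The
moduli space 𝔐 (regular stationary vacuum holes modulo isometry and homothety, C∞_loc topology) and
the level map on
it — a definition request, not an item; the Fredholm setting (b-Sobolev spaces, radial-point
regularity at 𝓔⁺, constraint
damping), the compactness theory (Cheeger–Gromov for stationary vacuum with horizon, Anderson-type
curvature bounds up to the
ergosurface), the zero-mode analysis off Kerr, the signed/parity refinement and the pairing law —
all layer-2 children of
Open/Closed. The dynamical leg is deliberately ONE opaque crux here (its decomposition belongs to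
dynamics routes that will
share it). The Kerr section of the level map (a ↦ a²/r₊², a bijection [0, M) → [0, 1)) and the D = 5
sanity census of the
card are numbers, not items.

CHEAPEST FALSIFIER. (i) Does subextremal Kerr satisfy the regularity predicate at all (else every
item is vacuous)? Checked by hand: on the
T-invariant patch M = {r > r₀}, r₋ < r₀ < r₊, of ingoing Kerr, g^{t*t*} = −(1 + 2Mr/Σ) < 0, causal
diamonds are compact
(inherited from the maximal development), and the bent slice X = {t* + f(r) = 0} (f' ≤ 0, f = 0 for
r ≥ r₊, f → ∞ at r₀)
is spacelike and met exactly once by every inextendible timelike curve (t* + f is strictly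
increasing and runs from −∞ to
+∞); level(Kerr_a) = sup_θ a² sin²θ/(r₊² + a² cos²θ) = a²/r₊² < 1, level(Schwarzschild) = 0. (ii)
Lookup: is a UNIVERSAL
ε₀ with no-hair for level < ε₀ already in print? No — AIK 2014's ε depends on the quantitative
constants A₁, R₁ of their
§1.2, so OpenUnderRotation is open even at s = 0. (iii) The refuter's fastest shot at Closed/Open:
any numerical stationary
vacuum D = 4 family off Kerr (none known); at the linear level, a horizon-regular static zero mode
on some Kerr beyond
δM, δa, gauge would break Open on the Kerr curve — excluded for all |a| < M by arXiv:2207.12952 Thm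
1.1.

NUMBERS. Kerr in the grading: T = ∂_{t*}, g(T,T)|_{r=r₊} = a² sin²θ/(r₊² + a² cos²θ), level = a²/r₊²
∈ [0,1), strictly increasing
in a/M, → 1 at extremality; κ = (r₊ − r₋)/(2(r₊² + a²)), Ω_H = a/(r₊² + a²), so level =
(Ω_H/κ)²·((r₊−r₋)/(2r₊))² —
the grading is a reparametrisation of the card's chart ratio Ω_H/κ along Kerr. AIK 2014: no-hair for
‖g(T,T)‖_L∞(S₀) < ε²,
ε = ε(A₁, R₁) (arXiv:1304.0487 (1.5), §1.2). Card's D = 5 sanity census (toy): preimage counts (MP,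
thin, fat) =
(1,0,0), (1,1,1)×3, (0,1,0)×2 over j² ∈ {0.5, 0.9, 0.95, 0.999, 1.2, 3.0}, signed count 1 with the
fat ring odd — in D = 5
the analogue of ClosedUnderRotation FAILS at the ring fold (27/32 = j²_min), as it must. Items at
open: 7 (1 target,
4 cruxes, 1 support, 1 assembly); after retriage rev 1–2 and repair rev 3: 1 target, 3 cruxes, 2
support, 1 assembly, same decl names. After the route-choice repair (rev 4): 8 items = 1 target, 3
cruxes, 3 support (+ LevelInduction, the glue cruxes → target), 1 assembly. After the
statement-revision repair (rev 6–9, 2026-08-16): same 8 items, 1 target, 4 cruxes (StaticAnchor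
re-kinded crux, crux-only deciding theorem), 2 support, 1 assembly; `closes` unchanged and
re-certified against the re-typed Statement.

DEFINITION REQUESTS. D1 (filed after open, `--kind definition --topic
Summits/FinalStateConjecture/FinalStateConjecture/Theorems`, for
OpenUnderRotation/ClosedUnderRotation): `StationaryVacuumModuli` — the space 𝔐 of classes, modulo
isometry of a
T-invariant neighbourhood of (d.o.c. ∪ 𝓔⁺) composed with homotheties g ↦ λ²g, of
`StationaryAFBlackHole.{0}` satisfying the
route's regularity predicate, Ric = 0, connected non-degenerate 𝓔⁺, T normalised; topology = C∞_loc
convergence of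
pulled-back (g, T) on compact subsets of a Cauchy collar through 𝓔⁺ plus uniform AF weighted
control; with the level map
s : 𝔐 → [0, ∞) and the Kerr curve [0, 1) → 𝔐. Cite facts wanted (filed as `--kind cite`, family gr):
Sudarsky–Wald
staticity theorem (PRD 47 (1993) R5209, Thm. 1); Chruściel–Wald maximal hypersurfaces (CMP 163
(1994) 561, Thm. 4.2 as
cited by AIK 2014 §1.1.1); Chruściel–Galloway static vacuum uniqueness without analyticity
(arXiv:1004.0513, Thm. 1.1);
later: AIK local rigidity near the bifurcation sphere (arXiv:0902.1173, Thm. 1.1) and AHW zero-mode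
rigidity
(arXiv:2207.12952, Thm. 6.1) for the layer-2 children.

Novelty: Searches (2026-08-15, this unit; local searchd and OpenAlex/S2 legs down or rate-limited): `lit
search --source zbmath`
"black hole uniqueness" ≥ 2014 (20: AIK 2014, Kunduri–Lucietti 1407.8002, Masood-ul-Alam 2019,
Aksteiner et al.
2306.14567 — none counts solutions), "rigidity stationary black holes small angular momentum" (4:
arXiv:1304.0487,
arXiv:1501.01587, arXiv:2407.16960, arXiv:1911.10560), "Anderson Einstein metrics conformal infinity
4-manifolds" (2:
math/0104171, math/0105243), "stationary vacuum black holes compactness" (2, irrelevant), "black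
hole uniqueness degree
theory moduli space stationary" (0), arXiv leg "uniqueness Kerr black hole continuity argument
angular momentum" (0);
`lit galaxy search --star all` ×3 ("black hole uniqueness degree theory", "degree theory for
Einstein metrics",
"continuity argument in the angular momentum": 0/0/0); `lit galaxy search --star pdf --mode bm25`
(question form, 12:
Hollands–Yazadjiev 0812.3036, Figueras–Murata–Reall 1107.5785, Booth gr-qc/0508107, Kehle–Unger
2211.15742 — none counts
stationary solutions); full-text reads: arXiv:1205.6112 §3.3–3.4, arXiv:1304.0487 §1,
arXiv:1501.01587 §4,
arXiv:2207.12952 §1; plus the card's battery (14 zbMATH queries, vsearch, galaxy) and the novelty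
audit of the card.
Nearest prior art found: math/0105243 (Anderson, GAFA 18 (2008): boundary map of AH Einstein metrics
is Fredholm of index
0, degree defined where proper, normalised to 1 at the rigid anchor, fillings counted with sign, AdS  [refs: 10.1103/PhysRevLett.26.331, 1304.0487, 1501.01587, 2407.16960, 1911.10560, 1205.6112, 2207.12952, 0909.4550, doi:10.1103/PhysRevLett.26.331]

Barriers (technique_class: fredholm-degree, static-anchor, continuity-method): - technique_class: fredholm-degree, static-anchor, continuity-method
- Literature.Barriers.FinalStateConjecture.IonescuKlainermanNonExtension: evaded — nothing is
continued off the horizon and no local injectivity is claimed at any rotating hole; Open/Closed are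
GLOBAL statements about the solution set, the horizon enters only as a radial set where smoothness
is a Fredholm side condition, and finite kernels (the global shadow of the I–K germs, if any survive
asymptotic flatness) are allowed and counted; the one uniqueness theorem invoked pointwise
(StaticAnchor, a = 0, the case the barrier's scope_caveat (a) leaves open anyway) is global-elliptic
(maximal slice + positive mass), outside the barrier's local class.
- Literature.Barriers.FinalStateConjecture.HairyKerrBifurcation: respected as delimiter, not met —
the line is NOT matter-insensitive: in Einstein–Klein–Gordon at the Chodosh–Shlapentokh-Rothman
masses the analogue of OpenUnderRotation is FALSE on the Kerr curve (hairy holes bifurcate at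
positive level), and our Open crux rests on the vacuum-specific zero-mode rigidity of Kerr
(arXiv:2207.12952, separated Teukolsky analysis) and on vacuum staticity at the anchor.
- Literature.Barriers.FinalStateConjecture.KerrSuperradiance: not met — no positivity of a conserved
energy is used; the count is of STATIONARY solutions and oscillatory (Re ω ≠ 0, superradiant) onsets
cannot change it; signs, when needed at layer 2, are spectral flow of the stationary operator, not a
Morse

History (route lifecycle, newest last):
- 2026-08-15T16:24:41Z · rev 3: restated GradedNoHair (stmt-FinalStateConjecture-10000), ClosedUnderRotation (stmt-FinalStateConjecture-10001), OpenUnderRotation (stmt-FinalStateConjecture-10002), StaticAnchor (stmt-FinalStateConjecture-10003), NoHairToFinalState (stmt-FinalStateConjecture-10004) — route-repair g2 (cone + vacuity): restate x5  (planner-rrepair-FinalStateConjecture-SignedCen-15e29f55-g2-0)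
- 2026-08-22T07:24:16Z · DORMANT — reconciler: no traction for 5.2 d (last activity item-evidence-added at 2026-08-17T02:49:09Z); parked, not closed — `ledger route dormant route-FinalStateConjec (operator:999:1680047)

sub-problem: FinalStateConjecture · status: dormant · opened planner-plancard-FinalStateConjecture-FinalSt-184514d0-0 2026-08-15T15:00:48Z · rev 10 · ledger route-FinalStateConjecture-SignedCensus
GENERATED by the gate from the ledger (D-0016/17). Provers cite these decls: `theorem foo : Summit.FinalStateConjecture.FinalStateConjecture.Theses.SignedCensus.<Decl> := …` in Summits/FinalStateConjecture/FinalStateConjecture/Theorems/<Name>.lean.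
-/

namespace Summit.FinalStateConjecture.FinalStateConjecture.Theses.SignedCensus

open scoped BigOperators Topology Manifold Classical MeasureTheory ProbabilityTheory Matrix InnerProductSpace ComplexConjugate ContinuousMap
open Filter Set Function TopologicalSpace MeasureTheory

attribute [summit_statement] _root_.FinalStateConjecture

-- earlier GradedNoHair (stmt-FinalStateConjecture-10000, replaced 2026-08-15T16:24:41Z -> stmt-FinalStateConjecture-10824): retired by None — ∀ s : ℝ, Literature.Geometry.Lorentzian.AlexakisIonescuKlainermanRigidity.{0} (fun 𝓑 ↦ 𝓑.metric.IsGloballyHyperbolic 𝓑.timeOrientation ∧ 𝓑.metric.IsCauchySurface 𝓑.timeOrientation (Set.range 𝓑.embed) ∧ IsConnected 𝓑.horizon ∧ (∀ [𝓑.metric.HasLeviCivita], 𝓑.toS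
/-- item stmt-FinalStateConjecture-10824 · target · rank 0 · open · by planner
why it might fail: It IS smooth black-hole rigidity (CCH12 Conj. 3.4) graded by s=sup_𝓔⁺ g(T,T): one exotic smooth stationary AF vacuum hole with connected non-degenerate horizon refutes it at its level; and the typed predicate (globally hyperbolic carrier, Cauchy hypersurface) is not I⁺-regularity (CC08 Def. 1.1).
sources: ChruscielCostaHeusler2012, ChruscielCosta2008, IonescuKlainerman2015, IonescuKlainerman2012, AlexakisIonescuKlainerman2009, AlexakisIonescuKlainerman2014
[target] rotation-graded smooth no-hair: for every s ∈ ℝ, every regular (globally hyperbolic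
carrier, the slice a Cauchy hypersurface) smooth stationary AF vacuum black hole with connected
non-degenerate future event horizon, stationary Killing field T normalised at infinity and g(T,T) ≤
s on the horizon, has d.o.c. isometric to a subextremal Kerr exterior (AIK schema at the graded
smooth predicate; card thesis 'SmoothNoHairOn every window'). (rev-3 typing, route-repair
2026-08-15: the Alexakis–Ionescu–Klainerman schema of BlackHoles.lean UNFOLDED over
`StationaryAFBlackHole` with curried hypotheses; 'regular' = `IsGloballyHyperbolic` + the CORRECTED
Cauchy notion `LorentzianMetric.IsCauchyHypersurface (Set.range 𝓑.embed)` (the rev-2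
`IsCauchySurface` clause was uninhabited, refuter evidence W_SC.lean); conclusion =
`IsIsometricToKerrExterior` unfolded pointwise: a C^∞ diffeomorphism Φ of the d.o.c. onto
`Kerr.exterior M a`, |a| < M, with g_Kerr(dΦ v, dΦ w) = g(v, w); the bookkeeping hypothesis `hres :
contMDiff_restrict` is dropped, `hF hP` (openness of I±) and `[Kerr.Facts]` kept.) -/
@[route_item "route-FinalStateConjecture-SignedCensus"]
def GradedNoHair : Prop :=
  ∀ s : ℝ, ∀ (𝓑 : Literature.Geometry.Lorentzian.StationaryAFBlackHole.{0}) [𝓑.metric.HasLeviCivita] [Literature.Geometry.Lorentzian.Kerr.Facts] (hF : 𝓑.metric.isOpen_chronologicalFuture 𝓑.timeOrientation) (hP : 𝓑.metric.isOpen_chronologicalPast 𝓑.timeOrientation), 𝓑.metric.IsGloballyHyperbolic 𝓑.timeOrientation → 𝓑.metric.IsCauchyHypersurface 𝓑.timeOrientation (Set.range 𝓑.embed) → IsConnected 𝓑.horizon → 𝓑.toSpacetime.IsNonDegenerateHorizon 𝓑.Mext → Filter.Tendsto (fun x ↦ 𝓑.metric.val (𝓑.embed x) (𝓑.killing (𝓑.embed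 x)) (𝓑.killing (𝓑.embed x))) (⨅ R : ℝ, Filter.principal (𝓑.e.far R)) (nhds (-1)) → (∀ p ∈ 𝓑.horizon, 𝓑.metric.val p (𝓑.killing p) (𝓑.killing p) ≤ s) → 𝓑.metric.toPseudoRiemannianMetric.IsRicciFlat → ∃ (M a : ℝ) (_ : Literature.Geometry.Lorentzian.Kerr.IsSubextremal M a) (Φ : Diffeomorph (𝓡 4) 𝓘(ℝ, Literature.Geometry.Lorentzian.E4) (𝓑.docOpens hF hP) (Literature.Geometry.Lorentzian.Kerr.exterior M a) ((⊤ : ℕ∞) : WithTop ℕ∞)), ∀ (y : 𝓑.docOpens hF hP) (v w : EuclideanSpace ℝ (Fin 4)), (Literature.Geometry.Lorentzian.Kerr.smoothMetric M a (Literature.Geometry.Lorentzian.Kerr.rPlus M a)).val (Φ y) (mfderiv (𝓡 4) 𝓘(ℝ, Literature.Geometry.Lorentzian.E4) Φ y v) (mfderiv (𝓡 4) 𝓘(ℝ, Literature.Geometry.Lorentzian.E4) Φ y w) = 𝓑.metric.val y.1 v w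

-- earlier ClosedUnderRotation (stmt-FinalStateConjecture-10001, replaced 2026-08-15T16:24:41Z -> stmt-FinalStateConjecture-10825): retired by None — ∀ s : ℝ, 0 < s → (∀ s' : ℝ, 0 ≤ s' → s' < s → Literature.Geometry.Lorentzian.AlexakisIonescuKlainermanRigidity.{0} (fun 𝓑 ↦ 𝓑.metric.IsGloballyHyperbolic 𝓑.timeOrientation ∧ 𝓑.metric.IsCauchySurface 𝓑.timeOrientation (Set.range 𝓑.embed) ∧ IsConnected 𝓑.
/-- item stmt-FinalStateConjecture-10825 · crux · rank 2 · open · by planner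
why it might fail: False iff the least level of some exotic hole is attained at an s₀>0: lower tip of a fold pair born away from Kerr (D=5 model: black-ring fold at j²=27/32) or an isolated exotic hole; in D=4 vacuum no tool in print (separability, Robinson identity, canonical-energy sign) forbids zero modes off Kerr.
sources: EmparanReall2002, EmparanReall2008, arXiv:1201.0463, doi:10.1103/PhysRevLett.26.331, Anderson2008, ChruscielCostaHeusler2012
[crux] the set of exotic-free rotation levels is left-closed: for s > 0, if no-hair holds up to
every level s' < s then it holds up to level s — no exotic hole is the FIRST of its kind (card K3:
no fold / odd-state exclusion off the Kerr curve; layer 2: the level map on the moduli space is open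
at every exotic point and the Kerr curve is properly embedded). (rev-3 typing, route-repair
2026-08-15: the Alexakis–Ionescu–Klainerman schema of BlackHoles.lean UNFOLDED over
`StationaryAFBlackHole` with curried hypotheses; 'regular' = `IsGloballyHyperbolic` + the CORRECTED
Cauchy notion `LorentzianMetric.IsCauchyHypersurface (Set.range 𝓑.embed)` (the rev-2
`IsCauchySurface` clause was uninhabited, refuter evidence W_SC.lean); conclusion =
`IsIsometricToKerrExterior` unfolded pointwise: a C^∞ diffeomorphism Φ of the d.o.c. onto
`Kerr.exterior M a`, |a| < M, with g_Kerr(dΦ v, dΦ w) = g(v, w); the bookkeeping hypothesis `hres :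
contMDiff_restrict` is dropped, `hF hP` (openness of I±) and `[Kerr.Facts]` kept.) [difficulty:
open-problem] -/
@[route_item "route-FinalStateConjecture-SignedCensus", crux]
def ClosedUnderRotation : Prop :=
  ∀ s : ℝ, 0 < s → (∀ s' : ℝ, 0 ≤ s' → s' < s → (∀ (𝓑 : Literature.Geometry.Lorentzian.StationaryAFBlackHole.{0}) [𝓑.metric.HasLeviCivita] [Literature.Geometry.Lorentzian.Kerr.Facts] (hF : 𝓑.metric.isOpen_chronologicalFuture 𝓑.timeOrientation) (hP : 𝓑.metric.isOpen_chronologicalPast 𝓑.timeOrientation), 𝓑.metric.IsGloballyHyperbolic 𝓑.timeOrientation → 𝓑.metric.IsCauchyHypersurface 𝓑.timeOrientation (Set.range 𝓑.embed) → IsConnected 𝓑.horizon → 𝓑.toSpacetime.IsNonDegenerateHorizon 𝓑.Mext → Filter.Tendsto (fun x ↦ 𝓑.metric.val (𝓑.embed x) (𝓑.killing (𝓑.embed x)) (𝓑.killing (𝓑.embed x))) (⨅ R : ℝ, Filter.principal (𝓑.e.far R)) (nhds (-1)) → (∀ p ∈ 𝓑.horizon, 𝓑.metric.val p (𝓑.killing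 p) (𝓑.killing p) ≤ s') → 𝓑.metric.toPseudoRiemannianMetric.IsRicciFlat → ∃ (M a : ℝ) (_ : Literature.Geometry.Lorentzian.Kerr.IsSubextremal M a) (Φ : Diffeomorph (𝓡 4) 𝓘(ℝ, Literature.Geometry.Lorentzian.E4) (𝓑.docOpens hF hP) (Literature.Geometry.Lorentzian.Kerr.exterior M a) ((⊤ : ℕ∞) : WithTop ℕ∞)), ∀ (y : 𝓑.docOpens hF hP) (v w : EuclideanSpace ℝ (Fin 4)), (Literature.Geometry.Lorentzian.Kerr.smoothMetric M a (Literature.Geometry.Lorentzian.Kerr.rPlus M a)).val (Φ y) (mfderiv (𝓡 4) 𝓘(ℝ, Literature.Geometry.Lorentzian.E4) Φ y v) (mfderiv (𝓡 4) 𝓘(ℝ, Literature.Geometry.Lorentzian.E4) Φ y w) = 𝓑.metric.val y.1 v w)) → ∀ (𝓑 : Literature.Geometry.Lorentzian.StationaryAFBlackHole.{0}) [𝓑.metric.HasLeviCivita] [Literature.Geometry.Lorentzian.Kerr.Facts] (hF : 𝓑.metric.isOpen_chronologicalFuture 𝓑.timeOrientation) (hP : 𝓑.metric.isOpen_chronologicalPast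 𝓑.timeOrientation), 𝓑.metric.IsGloballyHyperbolic 𝓑.timeOrientation → 𝓑.metric.IsCauchyHypersurface 𝓑.timeOrientation (Set.range 𝓑.embed) → IsConnected 𝓑.horizon → 𝓑.toSpacetime.IsNonDegenerateHorizon 𝓑.Mext → Filter.Tendsto (fun x ↦ 𝓑.metric.val (𝓑.embed x) (𝓑.killing (𝓑.embed x)) (𝓑.killing (𝓑.embed x))) (⨅ R : ℝ, Filter.principal (𝓑.e.far R)) (nhds (-1)) → (∀ p ∈ 𝓑.horizon, 𝓑.metric.val p (𝓑.killing p) (𝓑.killing p) ≤ s) → 𝓑.metric.toPseudoRiemannianMetric.IsRicciFlat → ∃ (M a : ℝ) (_ : Literature.Geometry.Lorentzian.Kerr.IsSubextremal M a) (Φ : Diffeomorph (𝓡 4) 𝓘(ℝ, Literature.Geometry.Lorentzian.E4) (𝓑.docOpens hF hP) (Literature.Geometry.Lorentzian.Kerr.exterior M a) ((⊤ : ℕ∞) : WithTop ℕ∞)), ∀ (y : 𝓑.docOpens hF hP) (v w : EuclideanSpace ℝ (Fin 4)), (Literature.Geometry.Lorentzian.Kerr.smoothMetric M a (Literature.Geometry.Lorentzian.Kerr.rPlus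 M a)).val (Φ y) (mfderiv (𝓡 4) 𝓘(ℝ, Literature.Geometry.Lorentzian.E4) Φ y v) (mfderiv (𝓡 4) 𝓘(ℝ, Literature.Geometry.Lorentzian.E4) Φ y w) = 𝓑.metric.val y.1 v w

-- earlier OpenUnderRotation (stmt-FinalStateConjecture-10002, replaced 2026-08-15T16:24:41Z -> stmt-FinalStateConjecture-10826): retired by None — ∀ s : ℝ, 0 ≤ s → Literature.Geometry.Lorentzian.AlexakisIonescuKlainermanRigidity.{0} (fun 𝓑 ↦ 𝓑.metric.IsGloballyHyperbolic 𝓑.timeOrientation ∧ 𝓑.metric.IsCauchySurface 𝓑.timeOrientation (Set.range 𝓑.embed) ∧ IsConnected 𝓑.horizon ∧ (∀ [𝓑.metric.HasLeviC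
/-- item stmt-FinalStateConjecture-10826 · crux · rank 3 · open · by planner
why it might fail: Needs a level-UNIFORM ε: compactness mod scale of regular stationary vacuum holes with bounded level + isolation of Kerr. In print only AIK14 Thm 1.1, ε=ε(Ā), Ā=max(R₁,A₂,ε₀⁻¹,(M²−J)⁻¹), under GR/SBS, Σ₁ maximal; nothing bounds Ā along a sequence (κ→0; ergoregion: Anderson's K/ρ² needs T timelike).
sources: AlexakisIonescuKlainerman2014, Anderson2000, AnderssonHafnerWhiting2022, HafnerHintzVasy2025, arXiv:1906.00860, arXiv:1012.4391
[crux] the set of exotic-free rotation levels is right-open: for s ≥ 0, no-hair up to level s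
implies no-hair up to some level s' > s (card K1+K2 at the frontier: compactness of regular
stationary vacuum holes with bounded level modulo scale and diffeomorphisms, plus isolation of the
Kerr family — horizon-regular stationary linearised operator Fredholm of index 0 with kernel = δKerr
⊕ gauge; at s = 0 this is a UNIVERSAL Alexakis–Ionescu–Klainerman strip). (rev-3 typing,
route-repair 2026-08-15: the Alexakis–Ionescu–Klainerman schema of BlackHoles.lean UNFOLDED over
`StationaryAFBlackHole` with curried hypotheses; 'regular' = `IsGloballyHyperbolic` + the CORRECTED
Cauchy notion `LorentzianMetric.IsCauchyHypersurface (Set.range 𝓑.embed)` (the rev-2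
`IsCauchySurface` clause was uninhabited, refuter evidence W_SC.lean); conclusion =
`IsIsometricToKerrExterior` unfolded pointwise: a C^∞ diffeomorphism Φ of the d.o.c. onto
`Kerr.exterior M a`, |a| < M, with g_Kerr(dΦ v, dΦ w) = g(v, w); the bookkeeping hypothesis `hres :
contMDiff_restrict` is dropped, `hF hP` (openness of I±) and `[Kerr.Facts]` kept.) [difficulty:
open-problem] -/
@[route_item "route-FinalStateConjecture-SignedCensus", crux]
def OpenUnderRotation : Prop :=
  ∀ s : ℝ, 0 ≤ s → (∀ (𝓑 : Literature.Geometry.Lorentzian.StationaryAFBlackHole.{0}) [𝓑.metric.HasLeviCivita] [Literature.Geometry.Lorentzian.Kerr.Facts] (hF : 𝓑.metric.isOpen_chronologicalFuture 𝓑.timeOrientation) (hP : 𝓑.metric.isOpen_chronologicalPast 𝓑.timeOrientation), 𝓑.metric.IsGloballyHyperbolic 𝓑.timeOrientation → 𝓑.metric.IsCauchyHypersurface 𝓑.timeOrientation (Set.range 𝓑.embed) → IsConnected 𝓑.horizon → 𝓑.toSpacetime.IsNonDegenerateHorizon 𝓑.Mext → Filter.Tendsto (fun x ↦ 𝓑.metric.val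 (𝓑.embed x) (𝓑.killing (𝓑.embed x)) (𝓑.killing (𝓑.embed x))) (⨅ R : ℝ, Filter.principal (𝓑.e.far R)) (nhds (-1)) → (∀ p ∈ 𝓑.horizon, 𝓑.metric.val p (𝓑.killing p) (𝓑.killing p) ≤ s) → 𝓑.metric.toPseudoRiemannianMetric.IsRicciFlat → ∃ (M a : ℝ) (_ : Literature.Geometry.Lorentzian.Kerr.IsSubextremal M a) (Φ : Diffeomorph (𝓡 4) 𝓘(ℝ, Literature.Geometry.Lorentzian.E4) (𝓑.docOpens hF hP) (Literature.Geometry.Lorentzian.Kerr.exterior M a) ((⊤ : ℕ∞) : WithTop ℕ∞)), ∀ (y : 𝓑.docOpens hF hP) (v w : EuclideanSpace ℝ (Fin 4)), (Literature.Geometry.Lorentzian.Kerr.smoothMetric M a (Literature.Geometry.Lorentzian.Kerr.rPlus M a)).val (Φ y) (mfderiv (𝓡 4) 𝓘(ℝ, Literature.Geometry.Lorentzian.E4) Φ y v) (mfderiv (𝓡 4) 𝓘(ℝ, Literature.Geometry.Lorentzian.E4) Φ y w) = 𝓑.metric.val y.1 v w) → ∃ s' : ℝ, s < s' ∧ (∀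 (𝓑 : Literature.Geometry.Lorentzian.StationaryAFBlackHole.{0}) [𝓑.metric.HasLeviCivita] [Literature.Geometry.Lorentzian.Kerr.Facts] (hF : 𝓑.metric.isOpen_chronologicalFuture 𝓑.timeOrientation) (hP : 𝓑.metric.isOpen_chronologicalPast 𝓑.timeOrientation), 𝓑.metric.IsGloballyHyperbolic 𝓑.timeOrientation → 𝓑.metric.IsCauchyHypersurface 𝓑.timeOrientation (Set.range 𝓑.embed) → IsConnected 𝓑.horizon → 𝓑.toSpacetime.IsNonDegenerateHorizon 𝓑.Mext → Filter.Tendsto (fun x ↦ 𝓑.metric.val (𝓑.embed x) (𝓑.killing (𝓑.embed x)) (𝓑.killing (𝓑.embed x))) (⨅ R : ℝ, Filter.principal (𝓑.e.far R)) (nhds (-1)) → (∀ p ∈ 𝓑.horizon, 𝓑.metric.val p (𝓑.killing p) (𝓑.killing p) ≤ s') → 𝓑.metric.toPseudoRiemannianMetric.IsRicciFlat → ∃ (M a : ℝ) (_ : Literature.Geometry.Lorentzian.Kerr.IsSubextremal M a) (Φ : Diffeomorph (𝓡 4) 𝓘(ℝ, Literature.Geometry.Lorentzian.E4) (𝓑.docOpens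 hF hP) (Literature.Geometry.Lorentzian.Kerr.exterior M a) ((⊤ : ℕ∞) : WithTop ℕ∞)), ∀ (y : 𝓑.docOpens hF hP) (v w : EuclideanSpace ℝ (Fin 4)), (Literature.Geometry.Lorentzian.Kerr.smoothMetric M a (Literature.Geometry.Lorentzian.Kerr.rPlus M a)).val (Φ y) (mfderiv (𝓡 4) 𝓘(ℝ, Literature.Geometry.Lorentzian.E4) Φ y v) (mfderiv (𝓡 4) 𝓘(ℝ, Literature.Geometry.Lorentzian.E4) Φ y w) = 𝓑.metric.val y.1 v w)

-- earlier StaticAnchor (stmt-FinalStateConjecture-10003, replaced 2026-08-15T16:24:41Z -> stmt-FinalStateConjecture-10827): retired by None — Literature.Geometry.Lorentzian.AlexakisIonescuKlainermanRigidity.{0} (fun 𝓑 ↦ 𝓑.metric.IsGloballyHyperbolic 𝓑.timeOrientation ∧ 𝓑.metric.IsCauchySurface 𝓑.timeOrientation (Set.range 𝓑.embed) ∧ IsConnected 𝓑.horizon ∧ (∀ [𝓑.metric.HasLeviCivita], 𝓑.toSpacetime.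
/-- item stmt-FinalStateConjecture-10827 · crux · rank 4 · open · by planner
why it might fail: Stronger than print as typed: SW93/CW94/CG10 consume CC08 I⁺-regularity (Def 1.1) + a T-witness (T≠0, ∇_T T=κT, κ≠0 on 𝓔⁺); from the route predicate (GH carrier, Cauchy slice, ∃K non-degenerate, T causal on 𝓔⁺) bridges B1 (⇒I⁺-regular), B2 (T-witness) are unproved (CC08 p.3); p99144: ⇐ SW∧CG∧B1∧B2.
sources: SudarskyWald1993, ChruscielWald1994, ChruscielCosta2008, ChruscielGalloway2010, ChruscielCostaHeusler2012, FriedrichRaczWald1999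
[support] level 0 is exotic-free: a regular smooth stationary AF vacuum black hole with connected
non-degenerate horizon on which the (normalised) stationary Killing field is causal — hence null and
tangent to the generators: a non-rotating horizon — has d.o.c. isometric to a Kerr exterior (indeed
Schwarzschild: maximal slice ⇒ Sudarsky–Wald staticity ⇒ static uniqueness without analyticity).
(rev-3 typing, route-repair 2026-08-15: the Alexakis–Ionescu–Klainerman schema of BlackHoles.lean
UNFOLDED over `StationaryAFBlackHole` with curried hypotheses; 'regular' = `IsGloballyHyperbolic` +
the CORRECTED Cauchy notion `LorentzianMetric.IsCauchyHypersurface (Set.range 𝓑.embed)` (the rev-2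
`IsCauchySurface` clause was uninhabited, refuter evidence W_SC.lean); conclusion =
`IsIsometricToKerrExterior` unfolded pointwise: a C^∞ diffeomorphism Φ of the d.o.c. onto
`Kerr.exterior M a`, |a| < M, with g_Kerr(dΦ v, dΦ w) = g(v, w); the bookkeeping hypothesis `hres :
contMDiff_restrict` is dropped, `hF hP` (openness of I±) and `[Kerr.Facts]` kept.) [difficulty: L] -/
@[route_item "route-FinalStateConjecture-SignedCensus", crux]
def StaticAnchor : Prop :=
  ∀ (𝓑 : Literature.Geometry.Lorentzian.StationaryAFBlackHole.{0}) [𝓑.metric.HasLeviCivita] [Literature.Geometry.Lorentzian.Kerr.Facts] (hF : 𝓑.metric.isOpen_chronologicalFuture 𝓑.timeOrientation) (hP : 𝓑.metric.isOpen_chronologicalPast 𝓑.timeOrientation), 𝓑.metric.IsGloballyHyperbolic 𝓑.timeOrientation → 𝓑.metric.IsCauchyHypersurface 𝓑.timeOrientation (Set.range 𝓑.embed) → IsConnected 𝓑.horizon → 𝓑.toSpacetime.IsNonDegenerateHorizon 𝓑.Mext → Filter.Tendsto (fun x ↦ 𝓑.metric.val (𝓑.embed x) (𝓑.killing (𝓑.embed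 x)) (𝓑.killing (𝓑.embed x))) (⨅ R : ℝ, Filter.principal (𝓑.e.far R)) (nhds (-1)) → (∀ p ∈ 𝓑.horizon, 𝓑.metric.val p (𝓑.killing p) (𝓑.killing p) ≤ 0) → 𝓑.metric.toPseudoRiemannianMetric.IsRicciFlat → ∃ (M a : ℝ) (_ : Literature.Geometry.Lorentzian.Kerr.IsSubextremal M a) (Φ : Diffeomorph (𝓡 4) 𝓘(ℝ, Literature.Geometry.Lorentzian.E4) (𝓑.docOpens hF hP) (Literature.Geometry.Lorentzian.Kerr.exterior M a) ((⊤ : ℕ∞) : WithTop ℕ∞)), ∀ (y : 𝓑.docOpens hF hP) (v w : EuclideanSpace ℝ (Fin 4)), (Literature.Geometry.Lorentzian.Kerr.smoothMetric M a (Literature.Geometry.Lorentzian.Kerr.rPlus M a)).val (Φ y) (mfderiv (𝓡 4) 𝓘(ℝ, Literature.Geometry.Lorentzian.E4) Φ y v) (mfderiv (𝓡 4) 𝓘(ℝ, Literature.Geometry.Lorentzian.E4) Φ y w) = 𝓑.metric.val y.1 v w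

-- earlier NoHairToFinalState (stmt-FinalStateConjecture-10004, replaced 2026-08-15T16:24:41Z -> stmt-FinalStateConjecture-10828): retired by None — (∀ s : ℝ, Literature.Geometry.Lorentzian.AlexakisIonescuKlainermanRigidity.{0} (fun 𝓑 ↦ 𝓑.metric.IsGloballyHyperbolic 𝓑.timeOrientation ∧ 𝓑.metric.IsCauchySurface 𝓑.timeOrientation (Set.range 𝓑.embed) ∧ IsConnected 𝓑.horizon ∧ (∀ [𝓑.metric.HasLeviCivita]
/-- item stmt-FinalStateConjecture-10828 · crux · rank 5 · open · by planner
why it might fail: = the RE-TYPED FSC (T2, p126844) given no-hair: WCC, large-data asymptotic stationarity, Kerr stability ∀|a|<M (print |a|≪M KS23/GKS22, a=0 DHRT21), subextremal limits via TAME m=1 genericity on one fixed end (no burial; thresholds, Kehle–Unger), honest radii, IsFutureOriented, RaysStayInClosure.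
sources: KlainermanSzeftel2023, GiorgiKlainermanSzeftel2022, arXiv:2205.14808, DafermosHolzegelRodnianskiTaylor2021, KehleUnger2024, DafermosLuk2017
[crux] the dynamical leg: rotation-graded smooth no-hair implies the final state conjecture as typed
(generic admissible data: MGHD, complete 𝓘⁺, d.o.c. settling to finitely many regular non-degenerate
stationary vacuum exteriors + radiation, which graded no-hair identifies as subextremal Kerr, with
exhaustive charts). Shared with every stationary-limit route; deliberately ranked last here. (rev-3
typing, route-repair 2026-08-15: the Alexakis–Ionescu–Klainerman schema of BlackHoles.lean UNFOLDED
over `StationaryAFBlackHole` with curried hypotheses; 'regular' = `IsGloballyHyperbolic` + the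
CORRECTED Cauchy notion `LorentzianMetric.IsCauchyHypersurface (Set.range 𝓑.embed)` (the rev-2
`IsCauchySurface` clause was uninhabited, refuter evidence W_SC.lean); conclusion =
`IsIsometricToKerrExterior` unfolded pointwise: a C^∞ diffeomorphism Φ of the d.o.c. onto
`Kerr.exterior M a`, |a| < M, with g_Kerr(dΦ v, dΦ w) = g(v, w); the bookkeeping hypothesis `hres :
contMDiff_restrict` is dropped, `hF hP` (openness of I±) and `[Kerr.Facts]` kept.) [deps:
GradedNoHair] [difficulty: open-problem] -/
@[route_item "route-FinalStateConjecture-SignedCensus", crux]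
def NoHairToFinalState : Prop :=
  (∀ s : ℝ, ∀ (𝓑 : Literature.Geometry.Lorentzian.StationaryAFBlackHole.{0}) [𝓑.metric.HasLeviCivita] [Literature.Geometry.Lorentzian.Kerr.Facts] (hF : 𝓑.metric.isOpen_chronologicalFuture 𝓑.timeOrientation) (hP : 𝓑.metric.isOpen_chronologicalPast 𝓑.timeOrientation), 𝓑.metric.IsGloballyHyperbolic 𝓑.timeOrientation → 𝓑.metric.IsCauchyHypersurface 𝓑.timeOrientation (Set.range 𝓑.embed) → IsConnected 𝓑.horizon → 𝓑.toSpacetime.IsNonDegenerateHorizon 𝓑.Mext → Filter.Tendsto (fun x ↦ 𝓑.metric.val (𝓑.embed x) (𝓑.killing (𝓑.embed x)) (𝓑.killing (𝓑.embed x))) (⨅ R : ℝ, Filter.principal (𝓑.e.far R)) (nhds (-1)) → (∀ p ∈ 𝓑.horizon, 𝓑.metric.val p (𝓑.killing p) (𝓑.killing p) ≤ s) → 𝓑.metric.toPseudoRiemannianMetric.IsRicciFlat → ∃ (M a : ℝ) (_ : Literature.Geometry.Lorentzian.Kerr.IsSubextremal M a) (Φ : Diffeomorph (𝓡 4) 𝓘(ℝ,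 Literature.Geometry.Lorentzian.E4) (𝓑.docOpens hF hP) (Literature.Geometry.Lorentzian.Kerr.exterior M a) ((⊤ : ℕ∞) : WithTop ℕ∞)), ∀ (y : 𝓑.docOpens hF hP) (v w : EuclideanSpace ℝ (Fin 4)), (Literature.Geometry.Lorentzian.Kerr.smoothMetric M a (Literature.Geometry.Lorentzian.Kerr.rPlus M a)).val (Φ y) (mfderiv (𝓡 4) 𝓘(ℝ, Literature.Geometry.Lorentzian.E4) Φ y v) (mfderiv (𝓡 4) 𝓘(ℝ, Literature.Geometry.Lorentzian.E4) Φ y w) = 𝓑.metric.val y.1 v w) → FinalStateConjecture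

/-- item stmt-FinalStateConjecture-10005 · support · rank 9 · closed · proved by Summit.FinalStateConjecture.FinalStateConjecture.Theorems.SignedCensus.censusUniqueness_proof @ 990b0e843c7c (prover) · by planner
sources: doi:10.2307/2039880, arXiv:0909.4550
[support] the abstract census in its no-fold form: a proper local homeomorphism from a Hausdorff
space onto a connected space one of whose fibres is a single point is injective (it is a finite
covering; fibre cardinality is locally constant). Layer-2 engine: with the moduli space 𝔐
(definition request), Π proper (Open) + Π a local homeomorphism (Closed) + the static fibre a
singleton (StaticAnchor) give GradedNoHair in one shot. [difficulty: provable-now] -/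
@[route_item "route-FinalStateConjecture-SignedCensus"]
def CensusUniqueness : Prop :=
  ∀ (𝔐 B : Type) [TopologicalSpace 𝔐] [T2Space 𝔐] [TopologicalSpace B] [T2Space B] [ConnectedSpace B] (chart : 𝔐 → B), IsProperMap chart → IsLocalHomeomorph chart → (∃ b : B, ∃! m : 𝔐, chart m = b) → Function.Injective chart

/-- item stmt-FinalStateConjecture-14321 · support · rank 9 · open · by planner
sources: arXiv:1304.0487, arXiv:1205.6112
[support] glue cruxes → target (route-choice repair 2026-08-16; clears the gate lint
`route.target-unreachable: no item concludes the target GradedNoHair`): StaticAnchor →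
OpenUnderRotation → ClosedUnderRotation → GradedNoHair — rotation-graded smooth no-hair for EVERY
level s follows from the static anchor (level 0), right-openness and left-closedness of the set of
exotic-free levels by real induction on s over the order-complete reals (P s antitone in s; t := inf
of the failing levels ≥ 0; P t by the anchor or by left-closedness; right-openness contradicts the
choice of t). Pure logic, provable now: it is verbatim the body of this route's deciding theorem
`closes` after its first line (planner check: Sketch.lean rc 0, kernel-closed). With it the item
graph reads cruxes → GradedNoHair → FinalStateConjecture (via NoHairToFinalState, whose hypothesis
is GradedNoHair unfolded). PROVERS: state and prove it in a Theses-free module in FRAME FORM (the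
four bodies inlined verbatim, pattern of Theorems/EIHFluxBalanceAssemblyFrame.lean and
Theorems/PhotonSphereChannelsAssemblyFrame.lean), so that the gate can render the `_holds` link
without the import cycle of the SwallowTheDatum rev-4 / P -/
@[route_item "route-FinalStateConjecture-SignedCensus"]
def LevelInduction : Prop :=
  StaticAnchor → OpenUnderRotation → ClosedUnderRotation → GradedNoHair

/-- item stmt-FinalStateConjecture-10006 · assembly · rank 1 · closed · proved by Summit.FinalStateConjecture.FinalStateConjecture.Theorems.SignedCensus.assembly_frame_proof (prover) · by planner
sources: arXiv:1304.0487, arXiv:1205.6112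
[assembly] StaticAnchor → OpenUnderRotation → ClosedUnderRotation → NoHairToFinalState →
FinalStateConjecture (real induction on the rotation level, then the dynamical leg). -/
@[route_item "route-FinalStateConjecture-SignedCensus"]
def Assembly : Prop :=
  StaticAnchor → OpenUnderRotation → ClosedUnderRotation → NoHairToFinalState → FinalStateConjecture

/-- `Assembly` holds: proved by `Summit.FinalStateConjecture.FinalStateConjecture.Theorems.SignedCensus.assembly_frame_proof`. -/
theorem Assembly_holds : Assembly := _root_.Summit.FinalStateConjecture.FinalStateConjecture.Theorems.SignedCensus.assembly_frame_proof

/-! D-0027 §2.1 — DECIDING THEOREM (planner-authored via `route open/edit --closes-file`; by planner-rrepair-FinalStateConjecture-SignedCen-63b3d6c8-0 2026-08-16T23:16:54Z):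
its hypotheses are this route's items and its conclusion the sub-problem Statement (glue_lint), and it elaborates with this file. -/

@[closes "route-FinalStateConjecture-SignedCensus"] theorem closes (hA : StaticAnchor) (hO : OpenUnderRotation) (hC : ClosedUnderRotation)
    (hD : NoHairToFinalState) : _root_.FinalStateConjecture := by
  apply hD
  -- `P s` := smooth no-hair up to horizon rotation level `s` (the common inlined graded statement)
  set P : ℝ → Prop := fun s ↦ ∀ (𝓑 : Literature.Geometry.Lorentzian.StationaryAFBlackHole.{0}) [𝓑.metric.HasLeviCivita] [Literature.Geometry.Lorentzian.Kerr.Facts] (hF : 𝓑.metric.isOpen_chronologicalFuture 𝓑.timeOrientation) (hP : 𝓑.metric.isOpen_chronologicalPast 𝓑.timeOrientation), 𝓑.metric.IsGloballyHyperbolic 𝓑.timeOrientation → 𝓑.metric.IsCauchyHypersurface 𝓑.timeOrientation (Set.range 𝓑.embed) → IsConnected 𝓑.horizon → 𝓑.toSpacetime.IsNonDegenerateHorizon 𝓑.Mext → Filter.Tendsto (fun x ↦ 𝓑.metric.val (𝓑.embed x) (𝓑.killing (𝓑.embed x)) (𝓑.killing (𝓑.embed x))) (⨅ R : ℝ, Filter.principal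 (𝓑.e.far R)) (nhds (-1)) → (∀ p ∈ 𝓑.horizon, 𝓑.metric.val p (𝓑.killing p) (𝓑.killing p) ≤ s) → 𝓑.metric.toPseudoRiemannianMetric.IsRicciFlat → ∃ (M a : ℝ) (_ : Literature.Geometry.Lorentzian.Kerr.IsSubextremal M a) (Φ : Diffeomorph (𝓡 4) 𝓘(ℝ, Literature.Geometry.Lorentzian.E4) (𝓑.docOpens hF hP) (Literature.Geometry.Lorentzian.Kerr.exterior M a) ((⊤ : ℕ∞) : WithTop ℕ∞)), ∀ (y : 𝓑.docOpens hF hP) (v w : EuclideanSpace ℝ (Fin 4)), (Literature.Geometry.Lorentzian.Kerr.smoothMetric M a (Literature.Geometry.Lorentzian.Kerr.rPlus M a)).val (Φ y) (mfderiv (𝓡 4) 𝓘(ℝ, Literature.Geometry.Lorentzian.E4) Φ y v) (mfderiv (𝓡 4) 𝓘(ℝ, Literature.Geometry.Lorentzian.E4) Φ y w) = 𝓑.metric.val y.1 v w with hP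
  -- a larger level is a stronger statement
  have mono : ∀ s s' : ℝ, s ≤ s' → P s' → P s := by
    intro s s' hss' h
    simp only [hP] at h ⊢
    intro 𝓑 _ _ hF hPa hgh hcs hconn hnd hfar hlev hvac
    exact h 𝓑 hF hPa hgh hcs hconn hnd hfar (fun p hp ↦ (hlev p hp).trans hss') hvac
  have h0 : P 0 := hA
  have hopen : ∀ s, 0 ≤ s → P s → ∃ s', s < s' ∧ P s' := hO
  have hclosed : ∀ s, 0 < s → (∀ s', 0 ≤ s' → s' < s → P s') → P s := hC
  -- real induction on the rotation level
  change ∀ s, P s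
  by_contra hnot
  push Not at hnot
  obtain ⟨s₀, hs₀⟩ := hnot
  set S : Set ℝ := {s | 0 ≤ s ∧ ¬ P s} with hS
  have hs₀S : max s₀ 0 ∈ S := by
    refine ⟨le_max_right _ _, fun h ↦ hs₀ (mono _ _ (le_max_left _ _) h)⟩
  have hne : S.Nonempty := ⟨_, hs₀S⟩
  have hbdd : BddBelow S := ⟨0, fun s hs ↦ hs.1⟩
  set t := sInf S with ht
  have ht0 : 0 ≤ t := le_csInf hne fun s hs ↦ hs.1
  have hbelow : ∀ s', 0 ≤ s' → s' < t → P s' := by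
    intro s' hs'0 hs't
    by_contra hns'
    exact (lt_irrefl _) ((csInf_le hbdd ⟨hs'0, hns'⟩).trans_lt hs't)
  have hPt : P t := by
    rcases ht0.eq_or_lt with h | h
    · rw [← h]; exact h0
    · exact hclosed t h hbelow
  obtain ⟨t', htt', hPt'⟩ := hopen t ht0 hPt
  obtain ⟨a, haS, hat'⟩ := exists_lt_of_csInf_lt hne htt'
  exact haS.2 (mono a t' hat'.le hPt')

end Summit.FinalStateConjecture.FinalStateConjecture.Theses.SignedCensus
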